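import Summits.BirchSwinnertonDyer.Rank1Residual.X11b.EmbeddingDatumPrime
import Summits.BirchSwinnertonDyer.Rank1Residual.X11b.HeegnerIdealRamified
import Summits.BirchSwinnertonDyer.Rank1Residual.X11b.CastellaErratumVersionOfRecord
import Literature.NumberTheory.EllipticCurves.BDPAnticyclotomicPAdicLFunction
import Literature.NumberTheory.EllipticCurves.Rank1Residual.Dedup
import Literature.NumberTheory.DiophantineGeometry.PastenValuationProductsProofs
import Literature.NumberTheory.QuadraticFields.HeegnerCondition
import HarnessLib

/-!
# X11b, route R1 — the BDP `p`-adic `L`-function EXISTS at every erratum-field datum of a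
# semistable R1 pair (`p ≥ 5`): Castella 2018 Thm. 3.1 (tree fact A206) instantiated on route R1's
# data — the first half of the route's open input discharged FROM PRINT

HONEST FRAMING (cell `b2b-bsdres`, run/shared/lean/b2b/bsd-rank1-residual/, verbatim in every
file): the goal of the cell is to DELETE the COMBINATION-SHAPED residual classes of the
Birch–Swinnerton-Dyer formula for ALL analytic-rank `≤ 1` elliptic curves over `ℚ` — "full BSD
formula for every rank `≤ 1` curve in class `C`" assembled STRICTLY from published theorems — so
that the rank-`≤ 1` remainder becomes exactly the CONSTRUCTION-SHAPED classes, which are TYPED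
(missing-input `Prop`s), NOT attempted. This is not "finishing BSD". Sub-cell
`b2b-bsdres-multr1-p1` (X11b, route R1); a RESEARCH ROUTE; no claim beyond the stated class; X11b
stays CONSTRUCTION-SHAPED; nothing here changes a label; no named fact (theorems only; the
PUBLISHED fact `castella2018_exists_isBDPLFunction` enters as a hypothesis `hBDP`; no `sorry`).

## What this file does (gen 20)

Route R1's ONE open input `R1OpenInputOnTreeAt W p` (`AnticyclotomicLogLinks.lean`) is the
COMPOSITE (IMC)∘(BDP) at the trivial character on the constructed `X_ac(E[p^∞])`: "`ord_p f_ac(0) =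
2·(ord_p log_ω P − 1)`" — Castella's `L_p(f)(𝟙)` was ELIMINATED between erratum Thm. 1.1 (OPEN) and
Cas18 Thm. 3.2 (PUB) because no `L_p(f)` existed in the tree. Since lit-prim-2's
`Literature/NumberTheory/EllipticCurves/BDPAnticyclotomicPAdicLFunction.lean` the tree HAS the
object: the characterising predicate `IsBDPLFunction ι 𝔭 κ γ f Ω_K Ω_p L` (`L ∈ R₀⟦T⟧ = Λ_{R₀}`,
Castella's interpolation property, Thm. 3.1) and the registered PUBLISHED fact (A206)
`castella2018_exists_isBDPLFunction` — Cas18 Thm. 3.1: for `p ≥ 5`, `E` semistable with `ρ̄_{E,p}`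
irreducible, `K` imaginary quadratic with `p` split and every prime of `N` of residue degree one in
`K`, `𝔭 ∣ p` the prime induced by the embedding datum `ι : ℚ̄_p ≃ ℂ`, `κ` anticyclotomic with
generator `γ`: `∃ Ω_K ≠ 0, Ω_p ∈ R₀ˣ, L` with `IsBDPLFunction ι 𝔭 κ γ f Ω_K Ω_p L`. That fact had no
consumer under `Summits/`. THIS FILE instantiates it at route R1's data:

* `exists_absNorm_eq_of_splitsIn` / `exists_absNorm_eq_of_dvd_discr` /
  **`IsErratumField.forall_exists_absNorm_eq`** — on an ERRATUM FIELD `K` for `(E, q)` (`q`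
  ramified, every other `ℓ ∣ N_E` split: Cas18 §5's choice of `K`) EVERY prime `ℓ ∣ N_E` has a prime
  of `K` of norm `ℓ` above it (split ⇒ `e = f = 1`, fundamental identity; ramified ⇒ `f = 1`,
  Dedekind) — the fact's (Heeg)-shaped hypothesis, i.e. Castella's generalized Heegner hypothesis
  "every prime factor of `N` is either split or ramified in `K`" (§3, p. 9);
* **`exists_isBDPLFunction_of_isErratumField`** — for `p ≥ 5`, `E` SEMISTABLE (`Squarefree N_E`,
  Silverman IV.10.2 via the tree's `isSemistable_iff_squarefree_conductorNorm`), `ρ̄_{E,p}`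
  irreducible, `p ∣ N_E`, `K` an erratum field for a prime `q ≠ p` (so `p` splits), `κ`
  anticyclotomic with topological generator `γ`, the newform `f` of `E` (level `N_E`), and ANY
  embedding datum `ι : ℚ̄_p ≃ ℂ`: `∃ Ω_K ≠ 0, Ω_p ∈ R₀ˣ, L ∈ R₀⟦T⟧` with
  `IsBDPLFunction ι 𝔭_ι κ γ f Ω_K Ω_p L`, where `𝔭_ι = primeOfEmbeddingDatum p ι w.embedding` is
  the prime INDUCED by `ι` (`EmbeddingDatumPrime.lean`; the compatibility clause holds by
  construction, `forall_mem_primeOfEmbeddingDatum_iff`);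
* `exists_isBDPLFunction_of_satisfiesHeegnerHypothesis` — the same under the CLASSICAL Heegner
  hypothesis (every prime of `N_E` split: route p2's / JSW's fields), offered to route p2;
* **`exists_isBDPLFunction_of_erratumHypotheses`** — the same from route R1's own binders
  (`ErratumHypotheses W p` = the hypotheses of the erratum's Thm. A′: `5 ≤ p`, `mult(p)`, `irr(p)`,
  A′-locus) on a SEMISTABLE pair, at an erratum field for `q ≠ p`: exactly the data over which
  `R1OpenInputOnTreeAt W p` quantifies, at the degree-one prime `𝔭_ι`
  (`degreeOne_primeOfEmbeddingDatum_of_isErratumField`: `e = f = 1`, so THE embedding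
  `embAt K p 𝔭_ι : K ↪ ℚ_p` of the open input is available there).

So on the SEMISTABLE part of `R1Population` (census `N < 5·10⁵`: `555 199` of `1 234 205` R1
pairs; REPORT §29) the EXISTENCE half (H1) of the composite open input is now a consequence of a
registered PUBLISHED fact; what remains typed at such a datum is (H2) the value of THAT `L` at `𝟙`
(Cas18 Thm. 3.2, PUB, to be typed over `IsBDPLFunction`) and (H3) the anticyclotomic IMC for THAT
`L` (erratum Thm. 1.1 ⇐ FW21 Thm. 4.41, PREPRINT) — `RouteR1Halves.lean` (successor file). For
NON-semistable R1 pairs Cas18 Thm. 3.1 is not printed (Castella's §2.1 standing "semistable"); H1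
stays typed there. CONDITIONAL on `hBDP` (PUB) and modularity (the newform `f` is a datum).
Nothing is asserted at `p = 3` (team x11b3's H1 `BDPExistsAt₃` is a different, unprinted
statement); nothing is booked; no label changes.

References: [Castella2018] §2.1, §3 Thm. 3.1 (arXiv:1704.06608 pp. 5, 9), §5 (choice of `K`,
p. 12); [CastellaHsieh2018] §3.3 (`i_p`, the induced prime); [Silverman1994] IV.10.2.
-/

noncomputable section

open scoped Classical

open WeierstrassCurve NumberField IsDedekindDomain Ideal Literature.NumberTheory.EllipticCurves
  Literature.NumberTheory.EllipticCurves.ModularForms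
  Literature.NumberTheory.EllipticCurves.Rank1Residual
  Literature.NumberTheory.GaloisRepresentations

namespace Summit.BirchSwinnertonDyer.Rank1Residual.X11b

/-! ### Degree-one primes above the primes of `N` in an erratum field (the (Heeg) clause) -/

section Heeg

variable {K : Type} [Field K] [NumberField K]

/-- **A split prime has a prime of norm `ℓ` above it**: for `[K : ℚ] = 2` and `ℓ` split in `K`
(two primes above `ℓ`), each prime `𝔩 ∣ ℓ` has `e = f = 1` (fundamental identity, tree
`SplitPrime.ramificationIdx_eq_one_of_ncard_primesOver`), hence `N(𝔩) = ℓ^{f} = ℓ`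
(Mathlib `Ideal.absNorm_eq_pow_inertiaDeg'`). [folklore] -/
theorem exists_absNorm_eq_of_splitsIn (h2 : Module.finrank ℚ K = 2) {ℓ : ℕ} (hℓ : ℓ.Prime)
    (hs : SplitsIn K ℓ) : ∃ v : HeightOneSpectrum (𝓞 K), absNorm v.asIdeal = ℓ := by
  have hne : ((span {(ℓ : ℤ)}).primesOver (𝓞 K)).Nonempty :=
    Set.nonempty_of_ncard_ne_zero (by rw [show _ = 2 from hs]; norm_num)
  obtain ⟨P, hP⟩ := hne
  haveI : P.IsPrime := hP.1
  haveI : P.LiesOver (span {(ℓ : ℤ)}) := hP.2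
  obtain ⟨-, hf⟩ :=
    Literature.NumberTheory.QuadraticFields.SplitPrime.ramificationIdx_eq_one_of_ncard_primesOver
      hℓ (hs.trans h2.symm) hP
  have hN : absNorm P = ℓ := by rw [absNorm_eq_pow_inertiaDeg' P hℓ, hf, pow_one]
  refine ⟨⟨P, hP.1, fun hbot ↦ hℓ.ne_zero ?_⟩, hN⟩
  rw [hbot, absNorm_bot] at hN
  exact_mod_cast hN.symm

/-- **A ramified prime has a prime of norm `q` above it**: for `[K : ℚ] = 2` and `q ∣ d_K` there is
a prime `𝔮 ∣ q` with `e = 2`, `f = 1` (Dedekind's discriminant theorem, tree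
`HeegnerIdeal.exists_prime_of_dvd_discr`), hence `N(𝔮) = q`. [folklore] -/
theorem exists_absNorm_eq_of_dvd_discr (h2 : Module.finrank ℚ K = 2) {q : ℕ} (hq : q.Prime)
    (hd : (q : ℤ) ∣ NumberField.discr K) :
    ∃ v : HeightOneSpectrum (𝓞 K), absNorm v.asIdeal = q := by
  obtain ⟨P, hP, hPo, -, hf⟩ := HeegnerIdeal.exists_prime_of_dvd_discr h2 hq hd
  haveI := hP
  haveI := hPo
  have hN : absNorm P = q := by rw [absNorm_eq_pow_inertiaDeg' P hq, hf, pow_one]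
  refine ⟨⟨P, hP, fun hbot ↦ hq.ne_zero ?_⟩, hN⟩
  rw [hbot, absNorm_bot] at hN
  exact_mod_cast hN.symm

variable {W : WeierstrassCurve ℚ} {q : ℕ}

/-- **The (Heeg)-shaped hypothesis of Castella 2018 Thm. 3.1 on an erratum field**: if `K` is an
erratum field for `(E, q)` (`q` ramified in `K`, every prime `ℓ ≠ q` of `N_E` split — Cas18 §5's
choice of `K`), then EVERY prime `ℓ ∣ N_E` has a prime of `𝓞 K` of norm `ℓ` ("every prime factor
of `N` is either split or ramified in `K`", Cas18 §3 p. 9, in the residue-degree-one form of the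
tree fact `castella2018_exists_isBDPLFunction`). [cite: Castella2018, §3 (arXiv:1704.06608 p. 9) and §5 (p. 12)] -/
theorem IsErratumField.forall_exists_absNorm_eq (hK : IsErratumField W K q) (hq : q.Prime) :
    ∀ ℓ : ℕ, ℓ.Prime → ℓ ∣ W.conductorNorm ℤ →
      ∃ v : HeightOneSpectrum (𝓞 K), absNorm v.asIdeal = ℓ := by
  intro ℓ hℓ hℓN
  by_cases h : ℓ = q
  · subst h
    exact exists_absNorm_eq_of_dvd_discr hK.1.1 hℓ hK.2.1
  · exact exists_absNorm_eq_of_splitsIn hK.1.1 hℓ (hK.2.2.1 ℓ hℓ hℓN h)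

/-- On an erratum field for `q ≠ p` with `p ∣ N_E`, `p` splits (two primes above `p`) — the
"`p = 𝔭𝔭̄` splits in `K`" of Cas18 §2.1 in the `ncard = 2` form of the tree fact. [folklore] -/
theorem IsErratumField.ncard_primesOver_eq_two (hK : IsErratumField W K q) {p : ℕ} (hp : p.Prime)
    (hpN : p ∣ W.conductorNorm ℤ) (hqp : q ≠ p) :
    ((span {(p : ℤ)}).primesOver (𝓞 K)).ncard = 2 :=
  hK.2.2.1 p hp hpN hqp.symm

/-- The prime `𝔭_ι` induced by an embedding datum has DEGREE ONE on an erratum field for `q ≠ p`,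
`p ∣ N_E` (`p` splits; `degreeOne_primeOfEmbeddingDatum`): the hypotheses `he`, `hf` under which
route R1's open input offers THE embedding `embAt K p 𝔭_ι`. [folklore] -/
theorem degreeOne_primeOfEmbeddingDatum_of_isErratumField (hK : IsErratumField W K q) {p : ℕ}
    [Fact p.Prime] (hpN : p ∣ W.conductorNorm ℤ) (hqp : q ≠ p) (ι : PadicAlgCl p ≃+* ℂ)
    (σ : K →+* ℂ) :
    (primeOfEmbeddingDatum p ι σ).asIdeal.ramificationIdx (𝓞 ℚ) = 1 ∧
      (primeOfEmbeddingDatum p ι σ).asIdeal.inertiaDeg (𝓞 ℚ) = 1 :=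
  degreeOne_primeOfEmbeddingDatum p ι hK.1.1 (hK.ncard_primesOver_eq_two Fact.out hpN hqp) σ

end Heeg

/-! ### Semistable ⟹ square-free conductor -/

section Semistable

variable {W : WeierstrassCurve ℚ} [W.IsElliptic]

/-- The cell's `Semistable W` (good or multiplicative at every prime) gives a SQUARE-FREE conductor
(Silverman ATAEC IV.10.2; tree `semistable_iff_isSemistable_int` ∘
`isSemistable_iff_squarefree_conductorNorm`) — the "`E` semistable of conductor `N`" of Cas18
§2.1 in the `Squarefree N` form of the tree fact. [cite: Silverman1994, IV.10.2] -/
theorem squarefree_conductorNorm_of_semistable (hss : Semistable W) :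
    Squarefree (W.conductorNorm ℤ) :=
  (WeierstrassCurve.isSemistable_iff_squarefree_conductorNorm W).mp
    ((semistable_iff_isSemistable_int (W := W)).mp hss)

end Semistable

/-! ### H1 (BDP-EXISTS) on route R1's data, from the published fact -/

section Exists

variable {p : ℕ} [Fact p.Prime] {W : WeierstrassCurve ℚ} [W.IsElliptic] [W.IsGloballyMinimal]
  [NeZero (W.conductorNorm ℤ)] {K : Type} [Field K] [NumberField K] {q : ℕ}

omit [W.IsGloballyMinimal] in
/-- **Castella 2018 Thm. 3.1 INSTANTIATED at an erratum-field datum of a semistable pair.** For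
`p ≥ 5`, `E` semistable with `ρ̄_{E,p}` irreducible and `p ∣ N_E`, `K` an erratum field for a prime
`q ≠ p` (Cas18 §5: `q` ramified, all other primes of `N_E` split — so `p` splits and every `ℓ ∣ N_E`
has a degree-one prime), an anticyclotomic `ℤ_p`-extension `κ` with topological generator `γ`, the
newform `f` of `E` (level `N_E`) and ANY embedding datum `ι : ℚ̄_p ≃ ℂ`: there are CM periods
`Ω_K ≠ 0`, `Ω_p ∈ R₀ˣ` and `L ∈ R₀⟦T⟧ = Λ_{R₀}` with Castella's interpolation property
`IsBDPLFunction ι 𝔭_ι κ γ f Ω_K Ω_p L` at the prime `𝔭_ι ∣ p` INDUCED by `ι`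
(`primeOfEmbeddingDatum`; the fact's compatibility clause holds by construction, `K` having one
infinite place). CONDITIONAL on the published fact `hBDP` (A206). This is H1 = BDP-EXISTS of the
route's open input, from print, on the semistable part of the population.
[cite: Castella2018, Thm. 3.1 (arXiv:1704.06608 p. 9)] -/
theorem exists_isBDPLFunction_of_isErratumField (hBDP : castella2018_exists_isBDPLFunction)
    (ι : PadicAlgCl p ≃+* ℂ) {f : CuspForm (CongruenceSubgroup.Gamma0 (W.conductorNorm ℤ)) 2}
    (hf : IsNewformOf W f) (h5 : 5 ≤ p) (hss : Semistable W) (hirr : Irr W p)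
    (hpN : p ∣ W.conductorNorm ℤ) (hq : q.Prime) (hqp : q ≠ p) (hK : IsErratumField W K q)
    (κ : ZpExtension K p) (hκ : κ.IsAnticyclotomic) (γ : Field.absoluteGaloisGroup K)
    (hγ : κ.IsTopGenerator γ) (w₀ : InfinitePlace K) :
    ∃ (ΩK : ℂ) (Ωp : (unrIntegers p)ˣ) (L : UnrSeries p), ΩK ≠ 0 ∧
      IsBDPLFunction ι (primeOfEmbeddingDatum p ι w₀.embedding) κ γ f ΩK
        ((Ωp : unrIntegers p) : ℂ_[p]) L :=
  hBDP ι W K (primeOfEmbeddingDatum p ι w₀.embedding) κ γ hf h5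
    (squarefree_conductorNorm_of_semistable hss) hirr hK.1
    (hK.ncard_primesOver_eq_two Fact.out hpN hqp)
    (natCast_mem_primeOfEmbeddingDatum p ι w₀.embedding)
    (forall_mem_primeOfEmbeddingDatum_iff p ι hK.1 w₀) (hK.forall_exists_absNorm_eq hq) hκ hγ

/-- **H1 (BDP-EXISTS) from route R1's own binders.** On a SEMISTABLE pair satisfying the erratum's
A′-hypotheses `ErratumHypotheses W p` (`5 ≤ p`, multiplicative at `p`, `E[p]` irreducible, the
A′-locus), at an erratum field `K` for a prime `q ≠ p` and anticyclotomic `(κ, γ)` — exactly the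
data over which `R1OpenInputOnTreeAt W p` quantifies — Castella's `L_p(f)` EXISTS in `Λ_{R₀}` with
its interpolation property at the induced degree-one prime `𝔭_ι`, for every embedding datum `ι`.
CONDITIONAL on the published facts `hBDP` (Cas18 Thm. 3.1, A206) and modularity (the newform `f`).
[cite: Castella2018, Thm. 3.1 (arXiv:1704.06608 p. 9)] [cite: Castella2018Erratum, Thm. A′ (p. 1), hypotheses] -/
theorem exists_isBDPLFunction_of_erratumHypotheses (hBDP : castella2018_exists_isBDPLFunction)
    (ι : PadicAlgCl p ≃+* ℂ) {f : CuspForm (CongruenceSubgroup.Gamma0 (W.conductorNorm ℤ)) 2}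
    (hf : IsNewformOf W f) (hE : ErratumHypotheses W p) (hss : Semistable W) [Fact q.Prime]
    (hqp : q ≠ p) (hK : IsErratumField W K q) (κ : ZpExtension K p) (hκ : κ.IsAnticyclotomic)
    (γ : Field.absoluteGaloisGroup K) [hγ : Fact (κ.IsTopGenerator γ)] (w₀ : InfinitePlace K) :
    ∃ (ΩK : ℂ) (Ωp : (unrIntegers p)ˣ) (L : UnrSeries p), ΩK ≠ 0 ∧
      IsBDPLFunction ι (primeOfEmbeddingDatum p ι w₀.embedding) κ γ f ΩK
        ((Ωp : unrIntegers p) : ℂ_[p]) L :=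
  exists_isBDPLFunction_of_isErratumField hBDP ι hf hE.1 hss hE.2.2.1
    (dvd_conductorNorm_of_mult hE.2.1) Fact.out hqp hK κ hκ γ hγ.out w₀

/-- The same with the degree-one data of `𝔭_ι` bundled: `p ∈ 𝔭_ι`, `e(𝔭_ι|p) = f(𝔭_ι|p) = 1` — the
three hypotheses `h𝔭 he hf` of `embAt K p 𝔭_ι` in `R1OpenInputOnTreeAt` — together with H1 at
`𝔭_ι`. [cite: Castella2018, Thm. 3.1 (arXiv:1704.06608 p. 9) and §2.2 (p. 5)] -/
theorem exists_degreeOne_and_isBDPLFunction_of_erratumHypotheses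
    (hBDP : castella2018_exists_isBDPLFunction) (ι : PadicAlgCl p ≃+* ℂ)
    {f : CuspForm (CongruenceSubgroup.Gamma0 (W.conductorNorm ℤ)) 2} (hf : IsNewformOf W f)
    (hE : ErratumHypotheses W p) (hss : Semistable W) [Fact q.Prime] (hqp : q ≠ p)
    (hK : IsErratumField W K q) (κ : ZpExtension K p) (hκ : κ.IsAnticyclotomic)
    (γ : Field.absoluteGaloisGroup K) [Fact (κ.IsTopGenerator γ)] (w₀ : InfinitePlace K) :
    ((p : ℕ) : 𝓞 K) ∈ (primeOfEmbeddingDatum p ι w₀.embedding).asIdeal ∧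
      (primeOfEmbeddingDatum p ι w₀.embedding).asIdeal.ramificationIdx (𝓞 ℚ) = 1 ∧
      (primeOfEmbeddingDatum p ι w₀.embedding).asIdeal.inertiaDeg (𝓞 ℚ) = 1 ∧
      ∃ (ΩK : ℂ) (Ωp : (unrIntegers p)ˣ) (L : UnrSeries p), ΩK ≠ 0 ∧
        IsBDPLFunction ι (primeOfEmbeddingDatum p ι w₀.embedding) κ γ f ΩK
          ((Ωp : unrIntegers p) : ℂ_[p]) L := by
  obtain ⟨he, hf1⟩ := degreeOne_primeOfEmbeddingDatum_of_isErratumField hK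
    (dvd_conductorNorm_of_mult hE.2.1) hqp ι w₀.embedding
  exact ⟨natCast_mem_primeOfEmbeddingDatum p ι w₀.embedding, he, hf1,
    exists_isBDPLFunction_of_erratumHypotheses hBDP ι hf hE hss hqp hK κ hκ γ w₀⟩

omit [W.IsGloballyMinimal] in
/-- **Castella 2018 Thm. 3.1 INSTANTIATED under the CLASSICAL Heegner hypothesis** (route p2's /
JSW's fields: EVERY prime of `N_E` split in `K`, tree `SatisfiesHeegnerHypothesis N_E K`). For
`p ≥ 5`, `E` semistable with `ρ̄_{E,p}` irreducible and `p ∣ N_E`, `K` imaginary quadratic with the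
Heegner hypothesis for `N_E` (so `p` splits and every `ℓ ∣ N_E` has a degree-one prime,
`exists_absNorm_eq_of_splitsIn`), anticyclotomic `(κ, γ)`, the newform `f` of `E` and any embedding
datum `ι`: `∃ Ω_K ≠ 0, Ω_p ∈ R₀ˣ, L` with `IsBDPLFunction ι 𝔭_ι κ γ f Ω_K Ω_p L`. (Offered to route
p2, whose open input `P2OpenInputOnTreeAt` quantifies over such `K`.) CONDITIONAL on `hBDP`.
[cite: Castella2018, Thm. 3.1 (arXiv:1704.06608 p. 9)] [cite: GrossLMS1991, §1 (p. 235)] -/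
theorem exists_isBDPLFunction_of_satisfiesHeegnerHypothesis
    (hBDP : castella2018_exists_isBDPLFunction) (ι : PadicAlgCl p ≃+* ℂ)
    {f : CuspForm (CongruenceSubgroup.Gamma0 (W.conductorNorm ℤ)) 2} (hf : IsNewformOf W f)
    (h5 : 5 ≤ p) (hss : Semistable W) (hirr : Irr W p) (hpN : p ∣ W.conductorNorm ℤ)
    (hK : IsImaginaryQuadratic K) (hH : SatisfiesHeegnerHypothesis (W.conductorNorm ℤ) K)
    (κ : ZpExtension K p) (hκ : κ.IsAnticyclotomic) (γ : Field.absoluteGaloisGroup K)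
    (hγ : κ.IsTopGenerator γ) (w₀ : InfinitePlace K) :
    ∃ (ΩK : ℂ) (Ωp : (unrIntegers p)ˣ) (L : UnrSeries p), ΩK ≠ 0 ∧
      IsBDPLFunction ι (primeOfEmbeddingDatum p ι w₀.embedding) κ γ f ΩK
        ((Ωp : unrIntegers p) : ℂ_[p]) L :=
  hBDP ι W K (primeOfEmbeddingDatum p ι w₀.embedding) κ γ hf h5
    (squarefree_conductorNorm_of_semistable hss) hirr hK (hH p Fact.out hpN)
    (natCast_mem_primeOfEmbeddingDatum p ι w₀.embedding)
    (forall_mem_primeOfEmbeddingDatum_iff p ι hK w₀)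
    (fun ℓ hℓ hℓN ↦ exists_absNorm_eq_of_splitsIn hK.1 hℓ (hH ℓ hℓ hℓN)) hκ hγ

end Exists

end Summit.BirchSwinnertonDyer.Rank1Residual.X11b

end
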